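import Summits.MatrixMultiplication.MatrixMultiplication.Theorems.OctaveBudgetLinearDecayTwoUpToFive
import HarnessLib

/-!
# OctaveBudgetLinearDecayTenOfRowThree — the printed-row rung of the octave budget
(decomp-mm cell, lens 5 «finite/base range + asymptotic regime + bridge», generation 10)

Landing form for item `stmt-MatrixMultiplication-30879` of `route-MatrixMultiplication-OctaveBudget`
(`Theses/OctaveBudget.lean`, rev 7):

* `linearDecayTenOfRowThree_holds : LinearDecayTenOfRowThree` — GIVEN the printed row `κ = 3` of the
  rectangular-exponent table, `ω(1,3,1) ≤ 4.198809` (i.e. `e(3) ≤ 0.198809`, the item's own hypothesis;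
  [cite: VassilevskaWilliamsXuXuZhou2024, Table 1]), the linear-decay law with constant `2` holds on
  `1 ≤ k ≤ 10`.

Proof.  With the unconditional rung `(2, 5)` (`OctaveBudgetLinearDecayTwoUpToFive.rung_two_five`, item
25357) and the antitone excess, `e(k) ≤ e(3) ≤ 0.198809 ≤ 2/10 ≤ 2/k` on `6 ≤ k ≤ 10`
(`rung_of_tail_bound`).  The same argument gives the rungs `LinearDecayTwoUpToEight` (item 25358) and
`LinearDecayTwoUpToTen` (item 26290) MODULO the row (`linearDecayTwoUpToEight_of_rowThree`,
`linearDecayTwoUpToTen_of_rowThree`) and modulo the named table (`…_of_table`); their unconditional forms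
need the certified `κ = 3` value and are not claimed here.  Currency: `K₀^print = 10`.

References: [cite: VassilevskaWilliamsXuXuZhou2024, Table 1]; [cite: LeGall2014, Thm 1.1].
-/

set_option linter.dupNamespace false -- `MatrixMultiplication.MatrixMultiplication` (summit = problem, D-0017)

noncomputable section

namespace Summit.MatrixMultiplication.MatrixMultiplication.Theorems.OctaveBudgetLinearDecayTenOfRowThree

open Literature.Computability.AlgebraicComplexity
open Summit.MatrixMultiplication.MatrixMultiplication.Theses.OctaveBudget
open Summit.MatrixMultiplication.MatrixMultiplication.Theorems.OctaveBudgetLinearDecayTwoUpToFive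

/-- Rung `(2, 10)` from the row `κ = 3`: `e(3) ≤ 0.198809` and `0.198809 · 10 ≤ 2`. -/
theorem rung_two_ten_of_rowThree (h3 : omegaRect ℂ 1 3 1 ≤ 4.198809) :
    ∀ k : ℕ, 1 ≤ k → k ≤ 10 → omegaRect ℂ 1 k 1 - (k + 1) ≤ 2 / k :=
  rung_of_tail_bound (k₁ := 5) (κ₀ := 3) (η := 0.198809) rung_two_five
    (by norm_num) (by linarith) (by norm_num)

/-- Item `stmt-MatrixMultiplication-30879` (the row `κ = 3` is its hypothesis). -/
theorem linearDecayTenOfRowThree_holds : LinearDecayTenOfRowThree :=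
  fun h3 => rung_two_ten_of_rowThree h3

/-- The rung `LinearDecayTwoUpToTen` (item 26290) modulo the row `κ = 3`. -/
theorem linearDecayTwoUpToTen_of_rowThree (h3 : omegaRect ℂ 1 3 1 ≤ 4.198809) : LinearDecayTwoUpToTen :=
  rung_two_ten_of_rowThree h3

/-- The rung `LinearDecayTwoUpToEight` (item 25358) modulo the row `κ = 3`. -/
theorem linearDecayTwoUpToEight_of_rowThree (h3 : omegaRect ℂ 1 3 1 ≤ 4.198809) :
    LinearDecayTwoUpToEight :=
  fun k hk hk8 => rung_two_ten_of_rowThree h3 k hk (by omega)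

/-- The row `κ = 3` is an entry of the named printed table `vxxz2024_omegaRect_table` (statement only,
[cite: VassilevskaWilliamsXuXuZhou2024, Table 1]). -/
theorem rowThree_of_table (hT : vxxz2024_omegaRect_table) : omegaRect ℂ 1 3 1 ≤ 4.198809 :=
  hT 3 4.198809 (by norm_num [vxxz2024Table])

/-- The rung `LinearDecayTwoUpToTen` (item 26290) modulo the named printed table. -/
theorem linearDecayTwoUpToTen_of_table (hT : vxxz2024_omegaRect_table) : LinearDecayTwoUpToTen :=
  linearDecayTwoUpToTen_of_rowThree (rowThree_of_table hT)

/-- The rung `LinearDecayTwoUpToEight` (item 25358) modulo the named printed table. -/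
theorem linearDecayTwoUpToEight_of_table (hT : vxxz2024_omegaRect_table) : LinearDecayTwoUpToEight :=
  linearDecayTwoUpToEight_of_rowThree (rowThree_of_table hT)

end Summit.MatrixMultiplication.MatrixMultiplication.Theorems.OctaveBudgetLinearDecayTenOfRowThree

end
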